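import Literature.NumberTheory.QuadraticFields.ReducedForms
import Mathlib.Analysis.SpecificLimits.Basic
import HarnessLib

/-!
# Few reduced forms have a small leading coefficient: `#{Q reduced : a_Q = n} ≤ ρ*(n)` and the
# rearrangement bound `Σ_{Q reduced} 1/a_Q ≤ h(D)/30 + 6.2605`

Topic `Literature/NumberTheory/QuadraticFields` (namespace
`Literature.NumberTheory.QuadraticFields.BinaryQuadraticForm`, sub-namespace `LeadingCoeff`). Everything in
this file is PROVED (theorems only; no definition, no named fact). Written for the cell `parity-realchar`
(SIEGEL INSTRUMENT, TARGET §2 row 16: the input `h/Σ_Q(1/a_Q)` of the class-summed Goldfeld–Schinzel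
inequality, `Literature/NumberTheory/LFunctions/RealZeroRepulsionOddClassSummed.lean`).

For a negative discriminant `D` the reduced primitive forms `Q = (a, b, c)` (`|b| ≤ a ≤ c`, Cox (2.7);
tree `reducedForms D`, `classNumber D = #reducedForms D`) with a GIVEN leading coefficient `a = n` are
determined by `b ∈ (−n, n]` with `b² ≡ D (mod 4n)` (`c = (b² − D)/(4n)`). Hence:

* `card_filter_fst_eq_le` — **`#{Q ∈ reducedForms D : a_Q = n} ≤ #{b ∈ (−n, n] : 4n ∣ b² − D}`**
  (Goldfeld–Schinzel's / Ralaivaosaona–Razakarinoro's `ν(a) ≤ 2^{ω(a)}` is the ideal-theoretic form of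
  the right side for fundamental `D`; here no arithmetic of `D` is used);
* `card_roots_le_of_forall_fin` — the right side depends on `D mod 4n` only, so a bound checked on the
  `4n` residues holds for every `D`;
* `card_fiber_le_table` — by one kernel evaluation (`decide`), for `n = 1, …, 29` the structure-free maxima
  `ρ*(n) = max_D #{b ∈ (−n, n] : 4n ∣ b² − D}` are at most
  `1,2,2,2,2,4,2,4,3,4,2,4,2,4,4,4,2,6,2,4,4,4,2,8,5,4,6,4,2` (in particular ONE reduced form has `a = 1`);
* `sum_one_div_le_of_card_fiber_le` — the rearrangement lemma: for any finite family of integers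
  `a_i ≥ 1` with `#{i : a_i = k+1} ≤ R_k` (`k < N`),
  `Σ_i 1/a_i ≤ #I/(N+1) + Σ_{k<N} R_k·(1/(k+1) − 1/(N+1))` (the sum is largest when the small values are
  filled to capacity);
* `sum_inv_fst_le` — **`Σ_{Q ∈ reducedForms D} 1/a_Q ≤ h(D)/30 + 6.2605`** for every `D < 0`
  (`N = 29`; the table sum is `48604049567/7763631876 = 6.26047…`); also the elementary
  `sum_inv_fst_le_half` (`≤ (h(D)+1)/2`, one form with `a = 1`) and `sum_inv_fst_le_card` (`≤ h(D)`).

So `h(D)/Σ_Q(1/a_Q) ≥ h/(h/30 + 6.2605)`, which is `≥ 10.49` once `h(D) ≥ 101` — compare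
Ralaivaosaona–Razakarinoro 2026, Lemma 2: `Σ_{a ≤ √d/2} ν(a)/a ≤ h(−d)/11` for `h(−d) ≥ 101`, `d > 3·10⁸`
(same rearrangement with `ν(a) ≤ 2^{ω(a)}` and `Σ_{n ≤ 34} 2^{ω(n)} = 101`).

## References

* [Cox2013] D. A. Cox, *Primes of the form x² + ny²*, 2nd ed., §2.A (2.7), Thm. 2.8, Thm. 2.13.
* [RalaivaosaonaRazakarinoro2026] D. Ralaivaosaona, F. B. Razakarinoro, J. Number Theory 281 (2026)
  795–829, Lemma 1 (`ν` multiplicative, `ν(p^α) = 1 + χ(p)`), Lemma 2 (the rearrangement).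
* [GoldfeldSchinzel1975] D. M. Goldfeld, A. Schinzel, Ann. Sc. Norm. Super. Pisa (4) 2 (1975) 571–583,
  Theorem 2 (form-sum bounds).
-/

open Finset

namespace Literature.NumberTheory.QuadraticFields.BinaryQuadraticForm

namespace LeadingCoeff

/-! ### Reduced forms with a given leading coefficient -/

/-- **`#{Q ∈ reducedForms D : a_Q = n} ≤ #{b ∈ (−n, n] : 4n ∣ b² − D}`** (`D < 0`): a reduced form
`(n, b, c)` has `−n < b ≤ n` (Cox (2.7): `|b| ≤ a`, and `b ≥ 0` if `|b| = a`), `b² − D = 4nc`, and is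
determined by `b`. [cite: Cox2013, §2.A eq. (2.7) and Thm. 2.8] -/
theorem card_filter_fst_eq_le {D : ℤ} (hD : D < 0) (n : ℤ) :
    ((reducedForms D).filter (fun Q => Q.1 = n)).card ≤
      ((Finset.Ioc (-n) n).filter (fun b => 4 * n ∣ b ^ 2 - D)).card := by
  classical
  refine Finset.card_le_card_of_injOn (fun Q => Q.2.1) (fun Q hQ => ?_) (fun Q hQ Q' hQ' h => ?_)
  · simp only [Finset.coe_filter, Set.mem_setOf_eq, Finset.mem_Ioc] at hQ ⊢
    obtain ⟨hQm, hQn⟩ := hQ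
    obtain ⟨hdisc, ha, -, hred⟩ := (mem_reducedForms_iff hD).1 hQm
    obtain ⟨h1, h2, -, h4⟩ := hred
    refine ⟨⟨?_, by rw [← hQn]; exact h2⟩, ?_⟩
    · rcases lt_or_eq_of_le h1 with hlt | heq
      · rw [← hQn]; exact hlt
      · have h0 : 0 ≤ Q.2.1 := h4 (Or.inl heq.symm)
        rw [← hQn]; omega
    · refine ⟨Q.2.2, ?_⟩
      have : Q.2.1 ^ 2 - 4 * Q.1 * Q.2.2 = D := hdisc
      rw [← hQn]; linarith
  · simp only [Finset.coe_filter, Set.mem_setOf_eq] at hQ hQ' h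
    obtain ⟨hQm, hQn⟩ := hQ
    obtain ⟨hQm', hQn'⟩ := hQ'
    obtain ⟨hdisc, ha, -, -⟩ := (mem_reducedForms_iff hD).1 hQm
    obtain ⟨hdisc', -, -, -⟩ := (mem_reducedForms_iff hD).1 hQm'
    have e1 : Q.2.1 ^ 2 - 4 * Q.1 * Q.2.2 = D := hdisc
    have e2 : Q'.2.1 ^ 2 - 4 * Q'.1 * Q'.2.2 = D := hdisc'
    rw [hQn] at e1 ha
    rw [hQn'] at e2
    rw [h] at e1
    have hc : Q.2.2 = Q'.2.2 := by
      have : 4 * n * (Q.2.2 - Q'.2.2) = 0 := by linarith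
      rcases mul_eq_zero.1 this with h0 | h0
      · omega
      · linarith
    exact Prod.ext (by rw [hQn, hQn']) (Prod.ext h hc)

/-- **The root count depends on `D mod 4n` only**: if `#{b ∈ (−n, n] : 4n ∣ b² − r} ≤ R` for every residue
`0 ≤ r < 4n`, then `#{b ∈ (−n, n] : 4n ∣ b² − D} ≤ R` for every integer `D`. [folklore]
[cite: Cox2013, §2.A Thm. 2.8] -/
theorem card_roots_le_of_forall_fin {n R : ℕ} (hn : 0 < n)
    (h : ∀ r : Fin (4 * n), ((Finset.Ioc (-(n : ℤ)) n).filter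
      (fun b => (4 * n : ℤ) ∣ b ^ 2 - ((r : ℕ) : ℤ))).card ≤ R)
    (D : ℤ) : ((Finset.Ioc (-(n : ℤ)) n).filter (fun b => (4 * n : ℤ) ∣ b ^ 2 - D)).card ≤ R := by
  set m : ℤ := 4 * n with hm
  have hm0 : 0 < m := by rw [hm]; exact_mod_cast (by omega : 0 < 4 * n)
  have hr0 : 0 ≤ D % m := Int.emod_nonneg _ hm0.ne'
  have hrm : D % m < m := Int.emod_lt_of_pos _ hm0
  have hlt : (D % m).toNat < 4 * n := by
    have : ((D % m).toNat : ℤ) < (4 * n : ℕ) := by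
      rw [Int.toNat_of_nonneg hr0]; push_cast; rw [← hm]; exact hrm
    exact_mod_cast this
  have key := h ⟨(D % m).toNat, hlt⟩
  have hcast : (((⟨(D % m).toNat, hlt⟩ : Fin (4 * n)) : ℕ) : ℤ) = D % m :=
    Int.toNat_of_nonneg hr0
  rw [hcast] at key
  have hset : (Finset.Ioc (-(n : ℤ)) n).filter (fun b => m ∣ b ^ 2 - D) =
      (Finset.Ioc (-(n : ℤ)) n).filter (fun b => m ∣ b ^ 2 - D % m) := by
    refine Finset.filter_congr fun b _ => ?_
    have e : b ^ 2 - D % m = (b ^ 2 - D) + m * (D / m) := by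
      have := Int.emod_add_ediv_mul D m
      linarith [mul_comm (D / m) m]
    rw [e, dvd_add_left (dvd_mul_right m (D / m))]
  rw [hset]
  exact key

/-- The table `ρ*(n)`, `n = 1, …, 29`, checked on all residues by the kernel: for every `k < 29` and every
residue `r mod 4(k+1)`, `#{b ∈ (−(k+1), k+1] : 4(k+1) ∣ b² − r} ≤ [1,2,2,2,2,4,2,4,3,4,2,4,2,4,4,4,2,6,2,4,4,4,2,8,5,4,6,4,2][k]`.
[folklore] [cite: Cox2013, §2.A Thm. 2.8] -/
private theorem table_decide : ∀ k : Fin 29, ∀ r : Fin (4 * ((k : ℕ) + 1)),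
    ((Finset.Ioc (-(((k : ℕ) + 1 : ℕ) : ℤ)) (((k : ℕ) + 1 : ℕ) : ℤ)).filter
      (fun b => (4 * ((k : ℕ) + 1 : ℕ) : ℤ) ∣ b ^ 2 - ((r : ℕ) : ℤ))).card ≤
      [1,2,2,2,2,4,2,4,3,4,2,4,2,4,4,4,2,6,2,4,4,4,2,8,5,4,6,4,2].getD k 0 := by
  decide +kernel

/-- **Leading-coefficient census for `n ≤ 29`**: for every `D < 0` and `k < 29`,
`#{Q ∈ reducedForms D : a_Q = k + 1} ≤ ρ*(k+1)` with
`ρ* = 1,2,2,2,2,4,2,4,3,4,2,4,2,4,4,4,2,6,2,4,4,4,2,8,5,4,6,4,2` (structure-free maxima over all residues;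
for fundamental `D` the sharper `ν(n) ≤ 2^{ω(n)}` of Ralaivaosaona–Razakarinoro's Lemma 1 would do slightly
better from `n = 9` on). [cite: RalaivaosaonaRazakarinoro2026, Lemma 1 and Lemma 2] -/
theorem card_fiber_le_table {D : ℤ} (hD : D < 0) (k : ℕ) (hk : k < 29) :
    ((reducedForms D).filter (fun Q => Q.1 = (k : ℤ) + 1)).card ≤
      [1,2,2,2,2,4,2,4,3,4,2,4,2,4,4,4,2,6,2,4,4,4,2,8,5,4,6,4,2].getD k 0 := by
  have h1 := card_filter_fst_eq_le hD ((k : ℤ) + 1)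
  have h2 := card_roots_le_of_forall_fin (n := k + 1) (R := [1,2,2,2,2,4,2,4,3,4,2,4,2,4,4,4,2,6,2,4,4,4,2,8,5,4,6,4,2].getD k 0)
    (Nat.succ_pos k) (table_decide ⟨k, hk⟩) D
  have e : (((k + 1 : ℕ) : ℤ)) = (k : ℤ) + 1 := by push_cast; ring
  rw [e] at h2
  exact h1.trans h2

/-! ### The rearrangement lemma -/

/-- **Rearrangement**: for a finite family of integers `a_i ≥ 1` such that at most `R_k` indices have
`a_i = k + 1` (`k < N`), `Σ_i 1/a_i ≤ #I/(N+1) + Σ_{k<N} R_k (1/(k+1) − 1/(N+1))` — pointwise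
`1/a ≤ 1/(N+1) + Σ_{k<N} [a = k+1](1/(k+1) − 1/(N+1))`, then interchange the sums. This is the counting
step of Ralaivaosaona–Razakarinoro's Lemma 2 ("the sum is larger if more small numbers `a` are represented").
[cite: RalaivaosaonaRazakarinoro2026, Lemma 2] -/
theorem sum_one_div_le_of_card_fiber_le {ι : Type*} (s : Finset ι) (a : ι → ℤ)
    (ha : ∀ i ∈ s, 1 ≤ a i) (N : ℕ) (R : ℕ → ℕ)
    (hR : ∀ k < N, (s.filter (fun i => a i = (k : ℤ) + 1)).card ≤ R k) :
    ∑ i ∈ s, (1 : ℝ) / (a i : ℝ) ≤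
      (s.card : ℝ) / ((N : ℝ) + 1) +
        ∑ k ∈ Finset.range N, (R k : ℝ) * (1 / ((k : ℝ) + 1) - 1 / ((N : ℝ) + 1)) := by
  classical
  -- pointwise majorant
  have hpt : ∀ i ∈ s, (1 : ℝ) / (a i : ℝ) ≤ 1 / ((N : ℝ) + 1) +
      ∑ k ∈ Finset.range N, (if a i = (k : ℤ) + 1 then (1 : ℝ) else 0) *
        (1 / ((k : ℝ) + 1) - 1 / ((N : ℝ) + 1)) := by
    intro i hi
    have hai : (1 : ℝ) ≤ a i := by exact_mod_cast ha i hi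
    have hnn : ∀ k ∈ Finset.range N, 0 ≤ (if a i = (k : ℤ) + 1 then (1 : ℝ) else 0) *
        (1 / ((k : ℝ) + 1) - 1 / ((N : ℝ) + 1)) := by
      intro k hk
      rw [Finset.mem_range] at hk
      refine mul_nonneg (by split_ifs <;> norm_num) ?_
      have hk' : (k : ℝ) + 1 ≤ (N : ℝ) + 1 := by
        have : (k : ℝ) ≤ N := by exact_mod_cast hk.le
        linarith
      have := one_div_le_one_div_of_le (by positivity : (0 : ℝ) < (k : ℝ) + 1) hk'
      linarith
    by_cases hle : a i ≤ (N : ℤ)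
    · -- `a i = k₀ + 1` with `k₀ < N`: the `k₀`-term alone gives `1/(k₀+1) − 1/(N+1)`
      obtain ⟨k₀, hk₀⟩ : ∃ k₀ : ℕ, a i = (k₀ : ℤ) + 1 := ⟨(a i - 1).toNat, by
        rw [Int.toNat_of_nonneg (by linarith [ha i hi])]; ring⟩
      have hk₀N : k₀ < N := by
        have : (k₀ : ℤ) + 1 ≤ N := by rw [← hk₀]; exact hle
        omega
      have hmem : k₀ ∈ Finset.range N := Finset.mem_range.2 hk₀N
      have hsingle := Finset.single_le_sum (f := fun k : ℕ => (if a i = (k : ℤ) + 1 then (1 : ℝ) else 0) *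
            (1 / ((k : ℝ) + 1) - 1 / ((N : ℝ) + 1))) hnn hmem
      simp only [if_pos hk₀, one_mul] at hsingle
      have hcast : (a i : ℝ) = (k₀ : ℝ) + 1 := by rw [hk₀]; push_cast; ring
      rw [hcast]
      linarith
    · -- `a i ≥ N + 1`
      push Not at hle
      have hge : (N : ℝ) + 1 ≤ (a i : ℝ) := by exact_mod_cast (show (N : ℤ) + 1 ≤ a i by omega)
      have h1 : (1 : ℝ) / (a i : ℝ) ≤ 1 / ((N : ℝ) + 1) :=
        one_div_le_one_div_of_le (by positivity) hge
      have h2 : 0 ≤ ∑ k ∈ Finset.range N, (if a i = (k : ℤ) + 1 then (1 : ℝ) else 0) *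
          (1 / ((k : ℝ) + 1) - 1 / ((N : ℝ) + 1)) := Finset.sum_nonneg hnn
      linarith
  -- sum and interchange
  calc ∑ i ∈ s, (1 : ℝ) / (a i : ℝ)
      ≤ ∑ i ∈ s, (1 / ((N : ℝ) + 1) +
          ∑ k ∈ Finset.range N, (if a i = (k : ℤ) + 1 then (1 : ℝ) else 0) *
            (1 / ((k : ℝ) + 1) - 1 / ((N : ℝ) + 1))) := Finset.sum_le_sum hpt
    _ = (s.card : ℝ) / ((N : ℝ) + 1) +
          ∑ k ∈ Finset.range N, ((s.filter (fun i => a i = (k : ℤ) + 1)).card : ℝ) *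
            (1 / ((k : ℝ) + 1) - 1 / ((N : ℝ) + 1)) := by
        rw [Finset.sum_add_distrib, Finset.sum_const, nsmul_eq_mul, Finset.sum_comm]
        congr 1
        · ring
        · refine Finset.sum_congr rfl fun k _ => ?_
          rw [← Finset.sum_mul, Finset.natCast_card_filter]
    _ ≤ (s.card : ℝ) / ((N : ℝ) + 1) +
          ∑ k ∈ Finset.range N, (R k : ℝ) * (1 / ((k : ℝ) + 1) - 1 / ((N : ℝ) + 1)) := by
        refine add_le_add le_rfl (Finset.sum_le_sum fun k hk => ?_)
        rw [Finset.mem_range] at hk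
        refine mul_le_mul_of_nonneg_right (by exact_mod_cast hR k hk) ?_
        have hk' : (k : ℝ) + 1 ≤ (N : ℝ) + 1 := by
          have : (k : ℝ) ≤ N := by exact_mod_cast hk.le
          linarith
        have := one_div_le_one_div_of_le (by positivity : (0 : ℝ) < (k : ℝ) + 1) hk'
        linarith

/-! ### The bounds for `Σ_{Q reduced} 1/a_Q` -/

/-- Reduced forms have `a ≥ 1`. [folklore] -/
private theorem one_le_fst {D : ℤ} (hD : D < 0) : ∀ Q ∈ reducedForms D, (1 : ℤ) ≤ Q.1 := fun Q hQ => by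
  obtain ⟨-, ha, -, -⟩ := (mem_reducedForms_iff hD).1 hQ
  omega

/-- **`Σ_{Q ∈ reducedForms D} 1/a_Q ≤ h(D)/30 + 6.2605`** for every `D < 0` (rearrangement with the
`ρ*`-table for `n ≤ 29`: `Σ_{k<29} ρ*(k+1)(1/(k+1) − 1/30) = 48604049567/7763631876 < 6.2605`).
[cite: RalaivaosaonaRazakarinoro2026, Lemma 2] -/
theorem sum_inv_fst_le {D : ℤ} (hD : D < 0) :
    ∑ Q ∈ reducedForms D, (1 : ℝ) / (Q.1 : ℝ) ≤ (classNumber D : ℝ) / 30 + 6.2605 := by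
  have h := sum_one_div_le_of_card_fiber_le (reducedForms D) (fun Q => Q.1) (one_le_fst hD) 29
    (fun k => [1,2,2,2,2,4,2,4,3,4,2,4,2,4,4,4,2,6,2,4,4,4,2,8,5,4,6,4,2].getD k 0)
    (fun k hk => card_fiber_le_table hD k hk)
  have hq : (∑ k ∈ Finset.range 29,
      (([1,2,2,2,2,4,2,4,3,4,2,4,2,4,4,4,2,6,2,4,4,4,2,8,5,4,6,4,2].getD k 0 : ℕ) : ℚ) *
        (1 / ((k : ℚ) + 1) - 1 / ((29 : ℕ) + 1 : ℚ))) ≤ 62605 / 10000 := by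
    decide +kernel
  have hr : (∑ k ∈ Finset.range 29,
      (([1,2,2,2,2,4,2,4,3,4,2,4,2,4,4,4,2,6,2,4,4,4,2,8,5,4,6,4,2].getD k 0 : ℕ) : ℝ) *
        (1 / ((k : ℝ) + 1) - 1 / (((29 : ℕ) : ℝ) + 1))) ≤ 6.2605 := by
    have := (Rat.cast_le (K := ℝ)).2 hq
    push_cast at this
    have e : ((29 : ℕ) : ℝ) = 29 := by norm_num
    rw [e]
    linarith
  have hc : ((reducedForms D).card : ℝ) = (classNumber D : ℝ) := rfl
  rw [hc] at h
  have e30 : ((29 : ℕ) : ℝ) + 1 = 30 := by norm_num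
  rw [e30] at h
  rw [show (((29 : ℕ) : ℝ)) = 29 by norm_num] at hr
  norm_num at h hr ⊢
  linarith

/-- **`Σ_{Q ∈ reducedForms D} 1/a_Q ≤ (h(D) + 1)/2`**: exactly one reduced form has `a = 1` (`N = 1`).
[cite: Cox2013, §2.A eq. (2.7) and Thm. 2.8] -/
theorem sum_inv_fst_le_half {D : ℤ} (hD : D < 0) :
    ∑ Q ∈ reducedForms D, (1 : ℝ) / (Q.1 : ℝ) ≤ ((classNumber D : ℝ) + 1) / 2 := by
  have h := sum_one_div_le_of_card_fiber_le (reducedForms D) (fun Q => Q.1) (one_le_fst hD) 1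
    (fun k => [1,2,2,2,2,4,2,4,3,4,2,4,2,4,4,4,2,6,2,4,4,4,2,8,5,4,6,4,2].getD k 0)
    (fun k hk => card_fiber_le_table hD k (by omega))
  have hc : ((reducedForms D).card : ℝ) = (classNumber D : ℝ) := rfl
  rw [hc] at h
  simp only [Finset.sum_range_one, List.getD_cons_zero, Nat.cast_one, Nat.cast_zero] at h
  norm_num at h ⊢
  linarith

/-- **`Σ_{Q ∈ reducedForms D} 1/a_Q ≤ h(D)`** (`a ≥ 1`). [cite: Cox2013, §2.A eq. (2.7)] -/
theorem sum_inv_fst_le_card {D : ℤ} (hD : D < 0) :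
    ∑ Q ∈ reducedForms D, (1 : ℝ) / (Q.1 : ℝ) ≤ (classNumber D : ℝ) := by
  have hc : ((reducedForms D).card : ℝ) = (classNumber D : ℝ) := rfl
  rw [← hc]
  have : ∑ Q ∈ reducedForms D, (1 : ℝ) / (Q.1 : ℝ) ≤ ∑ _Q ∈ reducedForms D, (1 : ℝ) :=
    Finset.sum_le_sum fun Q hQ => by
      have h1 : (1 : ℝ) ≤ Q.1 := by exact_mod_cast one_le_fst hD Q hQ
      rw [div_le_one (by linarith)]; exact h1
  rwa [Finset.sum_const, nsmul_eq_mul, mul_one] at this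

/-- **The ratio**: for `D < 0` with `h(D) ≥ 101`, `10.49 · Σ_Q 1/a_Q ≤ h(D)` (`h/(h/30 + 6.2605)` is
increasing in `h` and `> 10.49` at `h = 101`). [cite: RalaivaosaonaRazakarinoro2026, Lemma 2] -/
theorem ratio_ge_of_classNumber_ge {D : ℤ} (hD : D < 0) (hh : 101 ≤ classNumber D) :
    10.49 * ∑ Q ∈ reducedForms D, (1 : ℝ) / (Q.1 : ℝ) ≤ (classNumber D : ℝ) := by
  have h := sum_inv_fst_le hD
  have hhR : (101 : ℝ) ≤ classNumber D := by exact_mod_cast hh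
  nlinarith

end LeadingCoeff

end Literature.NumberTheory.QuadraticFields.BinaryQuadraticForm
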